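import Literature.NumberTheory.EllipticCurves.TwoDescent
import Literature.NumberTheory.EllipticCurves.MordellWeilTheoremProofs
import Mathlib.LinearAlgebra.FreeModule.ModN
import HarnessLib

/-!
# Rank bounds from the complete `2`-descent (Silverman AEC X.1): independence and counting

Two pieces of pure algebra that turn the complete `2`-descent map
`φ : E(F) → F*/(F*)² × F*/(F*)²` of an elliptic curve with rational `2`-torsion
(`WeierstrassCurve.Affine.Point.twoDescentMap`, kernel `2E(F)`, `TwoDescent.lean`,
Silverman, *The Arithmetic of Elliptic Curves*, 2nd ed., Prop. X.1.4) into RANK statements: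

* **Lower bounds** (`linearIndependent_of_twoTorsion`): if an additive map `ψ : E(F) → V` into an
  `𝔽₂`-vector space takes `ℤ/2`-linearly independent values on `P₁, …, P_r, T₁, T₂` (with
  `ψ T₃ = ψ T₁ + ψ T₂`), then `P₁, …, P_r` are `ℤ`-linearly independent in `E(F)`. This is the
  standard "independence modulo `2E(F) + E[2]`" argument (infinite `2`-descent on a relation
  `Σ aᵢ Pᵢ = 0`: if all `aᵢ` are even, halve and land in `E[2] = {O, T₁, T₂, T₃}`); in practice
  `ψ` is `φ` followed by finitely many quadratic characters (signs, parities of valuations,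
  residue symbols), cf. Silverman AEC X.1, proof of Prop. X.1.4 and Example X.1.5 / the exact
  sequence `0 → E(K)/2E(K) → Sel₂`.
* **Upper bounds** (`pow_finrank_add_two_le_natCard_range`): if `E(F)` is finitely generated
  (Mordell–Weil) and `ψ : E(F) → V` has kernel inside `2E(F)` and separates `O, T₁, T₂, T₁ + T₂`
  for two torsion points `T₁, T₂`, then `2 ^ (rank_ℤ E(F) + 2) ≤ #ψ(E(F))`: the count
  `#E(K)/2E(K) = 2^{r} · #E(K)[2]` of AEC VIII.§1–3 / X.1 in the inequality form needed to read
  off `r ≤ dim_{𝔽₂} (image of the descent map) - 2`.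

Also: the `2`-torsion of a curve with `SplitTwoTorsion e₁ e₂ e₃` is `{O, T₁, T₂, T₃}`
(`eq_zero_or_eq_twoTorsion_of_two_nsmul_eq_zero`, AEC III.2.3 / Prop. X.1.4 "`E[2] ⊆ E(K)`").
Everything here is proved; the group theory is Mathlib's (`LinearIndependent`,
`AddCommGroup.torsion`, `ModN`, `Module.free_of_finite_type_torsion_free'`).

## References

* J. H. Silverman, *The Arithmetic of Elliptic Curves*, 2nd ed., GTM 106 (2009), VIII.§1,
  Prop. X.1.4, Example X.1.5. [SilvermanAEC2009]
-/

noncomputable section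

open scoped Classical

/-! ### Counting: `2^(rank + 2) ≤ #ψ(A)` -/

namespace Literature.NumberTheory.EllipticCurves

variable {A V : Type*} [AddCommGroup A] [AddCommGroup V]

/-- **`2 ^ (rank_ℤ A + 2) ≤ #ψ(A)`.** Let `A` be a finitely generated abelian group and
`ψ : A → V` an additive map whose kernel consists of doubles (`ψ a = 0 → a ∈ 2A`) and which
separates the four torsion elements `0, t₁, t₂, t₁ + t₂` (`t₁, t₂` of finite order,
`ψ t₁, ψ t₂, ψ (t₁ + t₂) ≠ 0`, `ψ t₁ ≠ ψ t₂`). Then `ψ(A)`, if finite, has at least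
`2 ^ (rank_ℤ A + 2)` elements: `A ↠ (A/A_tors)/2 ≅ (ℤ/2)^r` kills `ker ψ ⊆ 2A`, so it factors
through `A/ker ψ ≅ ψ(A)`, and the kernel of the factored map contains the four classes of
`0, t₁, t₂, t₁ + t₂`. (The algebra of `#E(K)/2E(K) = 2^r #E(K)[2]`, Silverman AEC VIII.§1.)
[folklore] -/
theorem pow_finrank_add_two_le_natCard_range [Module.Finite ℤ A] (ψ : A →+ V)
    (hker : ∀ a, ψ a = 0 → ∃ b, a = 2 • b) {t₁ t₂ : A} (ht₁ : IsOfFinAddOrder t₁)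
    (ht₂ : IsOfFinAddOrder t₂) (h₁ : ψ t₁ ≠ 0) (h₂ : ψ t₂ ≠ 0) (h₃ : ψ (t₁ + t₂) ≠ 0)
    (h₁₂ : ψ t₁ ≠ ψ t₂) [Finite ψ.range] :
    2 ^ (Module.finrank ℤ A + 2) ≤ Nat.card ψ.range := by
  set T := AddCommGroup.torsion A with hT
  let π : A →ₗ[ℤ] A ⧸ T := (QuotientAddGroup.mk' T).toIntLinearMap
  have hπ : Function.Surjective π := QuotientAddGroup.mk'_surjective T
  haveI : Module.Finite ℤ (A ⧸ T) := Module.Finite.of_surjective π hπ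
  haveI : NoZeroSMulDivisors ℤ (A ⧸ T) := inferInstance
  haveI : Module.Free ℤ (A ⧸ T) := Module.free_of_finite_type_torsion_free'
  have hrank : Module.finrank ℤ (A ⧸ T) = Module.finrank ℤ A := by
    have hker' : LinearMap.ker π ≤ Submodule.torsion ℤ A := by
      intro x hx
      have hx' : x ∈ T := (QuotientAddGroup.eq_zero_iff x).mp (LinearMap.mem_ker.mp hx)
      rwa [hT, ← Submodule.torsion_int] at hx'
    rw [← (π.quotKerEquivOfSurjective hπ).finrank_eq]
    exact finrank_quotient_eq_of_le_torsion hker'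
  -- `g : A → (A/T)/2`, surjective, kills `ker ψ` and `T`
  let g : A →+ ModN (A ⧸ T) 2 := (ModN.mkQ 2).comp (QuotientAddGroup.mk' T)
  have hg : Function.Surjective g :=
    (Submodule.mkQ_surjective _).comp (QuotientAddGroup.mk'_surjective T)
  have hgT : ∀ t ∈ T, g t = 0 := fun t ht => by
    change ModN.mkQ 2 (QuotientAddGroup.mk' T t) = 0
    rw [QuotientAddGroup.mk'_apply, (QuotientAddGroup.eq_zero_iff t).mpr ht, map_zero]
  have hle : ψ.ker ≤ g.ker := by
    intro a ha
    obtain ⟨b, rfl⟩ := hker a ha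
    rw [AddMonoidHom.mem_ker]
    change ModN.mkQ 2 (QuotientAddGroup.mk' T (2 • b)) = 0
    rw [map_nsmul, ← natCast_zsmul]
    exact (Submodule.Quotient.mk_eq_zero _).mpr ⟨QuotientAddGroup.mk' T b, rfl⟩
  let Φ : A ⧸ ψ.ker →+ ModN (A ⧸ T) 2 := QuotientAddGroup.lift _ g hle
  have hΦ : Function.Surjective Φ := by
    intro y
    obtain ⟨a, rfl⟩ := hg y
    exact ⟨QuotientAddGroup.mk a, QuotientAddGroup.lift_mk _ hle a⟩
  -- `A / ker ψ ≅ ψ(A)` is finite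
  let e : A ⧸ ψ.ker ≃+ ψ.range := QuotientAddGroup.quotientKerEquivRange ψ
  haveI : Finite (A ⧸ ψ.ker) := Finite.of_equiv _ e.toEquiv.symm
  rw [← Nat.card_congr e.toEquiv]
  -- four distinct elements of `ker Φ`
  have hmemT : ∀ t, IsOfFinAddOrder t → (QuotientAddGroup.mk t : A ⧸ ψ.ker) ∈ Φ.ker := by
    intro t ht
    rw [AddMonoidHom.mem_ker]
    change Φ (QuotientAddGroup.mk t) = 0
    rw [QuotientAddGroup.lift_mk _ hle]
    exact hgT t ht
  have hmk : ∀ a b : A, (QuotientAddGroup.mk a : A ⧸ ψ.ker) = QuotientAddGroup.mk b ↔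
      ψ a = ψ b := by
    intro a b
    rw [QuotientAddGroup.eq, AddMonoidHom.mem_ker, map_add, map_neg, neg_add_eq_zero, eq_comm]
  have hcard4 : 4 ≤ Nat.card Φ.ker := by
    let q : A → A ⧸ ψ.ker := QuotientAddGroup.mk
    have hsub : ({q 0, q t₁, q t₂, q (t₁ + t₂)} : Set (A ⧸ ψ.ker)) ⊆ Φ.ker := by
      intro x hx
      simp only [Set.mem_insert_iff, Set.mem_singleton_iff] at hx
      rcases hx with rfl | rfl | rfl | rfl
      · exact hmemT 0 IsOfFinAddOrder.zero
      · exact hmemT t₁ ht₁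
      · exact hmemT t₂ ht₂
      · exact hmemT _ (ht₁.add ht₂)
    have h4 : ({q 0, q t₁, q t₂, q (t₁ + t₂)} : Set (A ⧸ ψ.ker)).ncard = 4 := by
      have e01 : q 0 ≠ q t₁ := fun h => h₁ (by rw [hmk, map_zero] at h; exact h.symm)
      have e02 : q 0 ≠ q t₂ := fun h => h₂ (by rw [hmk, map_zero] at h; exact h.symm)
      have e03 : q 0 ≠ q (t₁ + t₂) := fun h => h₃ (by rw [hmk, map_zero] at h; exact h.symm)
      have e12 : q t₁ ≠ q t₂ := fun h => h₁₂ ((hmk _ _).mp h)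
      have e13 : q t₁ ≠ q (t₁ + t₂) := fun h => h₂ (by
        have h' := (hmk _ _).mp h
        rwa [map_add, left_eq_add] at h')
      have e23 : q t₂ ≠ q (t₁ + t₂) := fun h => h₁ (by
        have h' := (hmk _ _).mp h
        rwa [map_add, right_eq_add] at h')
      rw [Set.ncard_insert_of_notMem, Set.ncard_insert_of_notMem, Set.ncard_pair e23]
      · simp only [Set.mem_insert_iff, Set.mem_singleton_iff, not_or]
        exact ⟨e12, e13⟩
      · simp only [Set.mem_insert_iff, Set.mem_singleton_iff, not_or]
        exact ⟨e01, e02, e03⟩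
    rw [← SetLike.coe_sort_coe, Nat.card_coe_set_eq, ← h4]
    exact Set.ncard_le_ncard hsub (Set.toFinite _)
  have hprod := AddSubgroup.card_eq_card_quotient_mul_card_addSubgroup Φ.ker
  rw [Nat.card_congr (QuotientAddGroup.quotientKerEquivOfSurjective Φ hΦ).toEquiv,
    ModN.natCard_eq, hrank] at hprod
  rw [hprod, pow_add]
  exact Nat.mul_le_mul_left _ (by simpa using hcard4)

end Literature.NumberTheory.EllipticCurves

/-! ### The `2`-torsion and independence of points -/

namespace WeierstrassCurve.Affine.Point

/- No `[DecidableEq F]` variable: the group law on `W.Point` is elaborated against the classical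
instance (`open scoped Classical`), as in `TwoTorsion.lean` and `MordellWeil.lean`, so that the
statements apply verbatim to `WeierstrassCurve.mordellWeilRank`. -/
variable {F : Type*} [Field F] [CharZero F] {W : Affine F} [W.IsElliptic] {e₁ e₂ e₃ : F}

/-- **`E[2] = {O, T₁, T₂, T₃}`** for a curve with rational `2`-torsion `e₁, e₂, e₃`
(`SplitTwoTorsion`): a point `P` with `2P = O` is `O` or one of `Tᵢ = (eᵢ, -(a₁eᵢ + a₃)/2)`
(its abscissa is a root of `Ψ₂Sq = 4(X - e₁)(X - e₂)(X - e₃)`, tree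
`WeierstrassCurve.isRoot_Ψ₂Sq_of_two_nsmul_eq_zero` and `SplitTwoTorsion.Ψ₂Sq_eq_prod`, and a
point with abscissa `eᵢ` is `Tᵢ`, `eq_twoTorsionY_of_eq`). Silverman AEC III.2.3 and Prop. X.1.4
(hypothesis `E[2] ⊆ E(K)`). Deliberate dot-notation extension of Mathlib's
`WeierstrassCurve.Affine.Point`. [cite: SilvermanAEC2009, Prop. X.1.4] -/
theorem eq_zero_or_eq_twoTorsion_of_two_nsmul_eq_zero (h : W.SplitTwoTorsion e₁ e₂ e₃)
    {P : W.Point} (hP : (2 : ℕ) • P = 0) :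
    P = 0 ∨ P = some e₁ _ (nonsingular_twoTorsion h) ∨
      P = some e₂ _ (nonsingular_twoTorsion h.swap₁₂) ∨
      P = some e₃ _ (nonsingular_twoTorsion h.swap₂₃.swap₁₂) := by
  rcases P with _ | ⟨x, y, hxy⟩
  · exact Or.inl rfl
  · right
    have hroot := WeierstrassCurve.isRoot_Ψ₂Sq_of_two_nsmul_eq_zero (E := W) hxy hP
    rw [SplitTwoTorsion.Ψ₂Sq_eq_prod h, Polynomial.IsRoot.def] at hroot
    simp only [Polynomial.eval_mul, Polynomial.eval_C, Polynomial.eval_sub, Polynomial.eval_X,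
      mul_eq_zero, OfNat.ofNat_ne_zero, false_or, sub_eq_zero] at hroot
    rcases hroot with (rfl | rfl) | rfl
    · left
      have hy := eq_twoTorsionY_of_eq h hxy
      subst hy
      rfl
    · right; left
      have hy := eq_twoTorsionY_of_eq h.swap₁₂ hxy
      subst hy
      rfl
    · right; right
      have hy := eq_twoTorsionY_of_eq h.swap₂₃.swap₁₂ hxy
      subst hy
      rfl

/-- **Independence of points from the `2`-descent** (Silverman AEC X.1, the injection
`E(K)/2E(K) ↪ K*/(K*)² × K*/(K*)²` of Prop. X.1.4 in use). Let `E/F` have rational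
`2`-torsion `T₁, T₂, T₃` (`SplitTwoTorsion e₁ e₂ e₃`) and let `ψ : E(F) → V` be additive into
a `ℤ/2`-vector space (so `ψ(2E(F)) = 0`; typically the `2`-descent map followed by quadratic
characters) with `ψ T₃ = ψ T₁ + ψ T₂`. If the only `ℤ/2`-linear relation
`Σ cᵢ ψ(Pᵢ) + ε₁ ψ(T₁) + ε₂ ψ(T₂) = 0` is the trivial one, then `P₁, …, P_r` are
`ℤ`-linearly independent in `E(F)` (hence `r ≤ rank_ℤ E(F)`): on a relation `Σ aᵢ Pᵢ = 0`,
applying `ψ` shows all `aᵢ` even; halving gives a point of `E[2] = {O, T₁, T₂, T₃}`, where a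
value `Tⱼ` is excluded by applying `ψ` again, and `O` lets one descend.
[cite: SilvermanAEC2009, Prop. X.1.4] -/
theorem linearIndependent_of_twoTorsion (h : W.SplitTwoTorsion e₁ e₂ e₃) {V : Type*}
    [AddCommGroup V] [Module (ZMod 2) V] (ψ : W.Point →+ V) {r : ℕ} (P : Fin r → W.Point)
    (h₃ : ψ (some e₃ _ (nonsingular_twoTorsion h.swap₂₃.swap₁₂)) =
      ψ (some e₁ _ (nonsingular_twoTorsion h)) + ψ (some e₂ _ (nonsingular_twoTorsion h.swap₁₂)))
    (hind : ∀ (c : Fin r → ZMod 2) (ε₁ ε₂ : ZMod 2),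
      ∑ i, c i • ψ (P i) + ε₁ • ψ (some e₁ _ (nonsingular_twoTorsion h)) +
        ε₂ • ψ (some e₂ _ (nonsingular_twoTorsion h.swap₁₂)) = 0 → c = 0 ∧ ε₁ = 0 ∧ ε₂ = 0) :
    LinearIndependent ℤ P := by
  set T₁ : W.Point := some e₁ _ (nonsingular_twoTorsion h) with hT₁
  set T₂ : W.Point := some e₂ _ (nonsingular_twoTorsion h.swap₁₂) with hT₂
  set T₃ : W.Point := some e₃ _ (nonsingular_twoTorsion h.swap₂₃.swap₁₂) with hT₃
  -- `ψ (Σ gᵢ Pᵢ) = Σ (gᵢ mod 2) ψ(Pᵢ)`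
  have hψsum : ∀ g : Fin r → ℤ,
      ψ (∑ i, g i • P i) = ∑ i, ((g i : ℤ) : ZMod 2) • ψ (P i) := by
    intro g
    rw [map_sum]
    refine Finset.sum_congr rfl fun i _ => ?_
    rw [map_zsmul, Int.cast_smul_eq_zsmul]
  -- the values `Tⱼ` are excluded, and `O` forces all coefficients even
  have hT : ∀ g : Fin r → ℤ, ∑ i, g i • P i ≠ T₁ ∧ ∑ i, g i • P i ≠ T₂ ∧
      ∑ i, g i • P i ≠ T₃ := by
    intro g
    refine ⟨fun hg => ?_, fun hg => ?_, fun hg => ?_⟩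
    · have key := congrArg ψ hg
      rw [hψsum] at key
      have := (hind (fun i => (g i : ZMod 2)) 1 0 (by
        rw [key, one_smul, zero_smul, add_zero, ZModModule.add_self])).2.1
      exact one_ne_zero this
    · have key := congrArg ψ hg
      rw [hψsum] at key
      have := (hind (fun i => (g i : ZMod 2)) 0 1 (by
        rw [key, one_smul, zero_smul, add_zero, ZModModule.add_self])).2.2
      exact one_ne_zero this
    · have key := congrArg ψ hg
      rw [hψsum, h₃] at key
      have := (hind (fun i => (g i : ZMod 2)) 1 1 (by
        rw [key, one_smul, one_smul, add_assoc, add_add_add_comm,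
          ZModModule.add_self, ZModModule.add_self, add_zero])).2.1
      exact one_ne_zero this
  have heven : ∀ g : Fin r → ℤ, ∑ i, g i • P i = 0 → ∀ i, 2 ∣ g i := by
    intro g hg i
    have key := (congrArg ψ hg).trans ψ.map_zero
    rw [hψsum] at key
    have := (hind (fun i => (g i : ZMod 2)) 0 0 (by rw [key, zero_smul, zero_smul]; abel)).1
    have hi := congrFun this i
    simp only [Pi.zero_apply] at hi
    exact (ZMod.intCast_zmod_eq_zero_iff_dvd (g i) 2).mp hi
  -- descent on `Σ |gᵢ|`
  rw [Fintype.linearIndependent_iff]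
  suffices key : ∀ (N : ℕ) (g : Fin r → ℤ), ∑ i, (g i).natAbs ≤ N → ∑ i, g i • P i = 0 →
      ∀ i, g i = 0 from fun g hg => key _ g le_rfl hg
  intro N
  induction N with
  | zero =>
    intro g hN _ i
    have := (Finset.sum_eq_zero_iff_of_nonneg fun i _ => Nat.zero_le _).mp (Nat.le_zero.mp hN)
      i (Finset.mem_univ i)
    exact Int.natAbs_eq_zero.mp this
  | succ N ih =>
    intro g hN hg
    by_contra hne
    obtain ⟨j, hj⟩ : ∃ j, g j ≠ 0 := not_forall.mp hne
    choose g' hg' using heven g hg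
    -- `2 • Σ g'ᵢ Pᵢ = 0`, so `Σ g'ᵢ Pᵢ ∈ E[2]`; it is not `Tⱼ`, hence `0`
    have hsum' : (2 : ℕ) • ∑ i, g' i • P i = 0 := by
      rw [← hg, Finset.smul_sum]
      refine Finset.sum_congr rfl fun i _ => ?_
      rw [hg' i, mul_zsmul, ofNat_zsmul]
    have h0 : ∑ i, g' i • P i = 0 := by
      rcases eq_zero_or_eq_twoTorsion_of_two_nsmul_eq_zero h hsum' with h0 | h0 | h0 | h0
      · exact h0
      · exact absurd h0 (hT g').1
      · exact absurd h0 (hT g').2.1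
      · exact absurd h0 (hT g').2.2
    -- descend: `Σ |g'ᵢ| < Σ |gᵢ|`
    have hlt : ∑ i, (g' i).natAbs < ∑ i, (g i).natAbs := by
      have hle : ∀ i, (g' i).natAbs ≤ (g i).natAbs := fun i => by
        rw [hg' i, Int.natAbs_mul]
        exact Nat.le_mul_of_pos_left _ (by norm_num)
      have hj' : (g' j).natAbs < (g j).natAbs := by
        have hgj : g' j ≠ 0 := fun h0' => hj (by rw [hg' j, h0', mul_zero])
        rw [hg' j, Int.natAbs_mul, show (2 : ℤ).natAbs = 2 from rfl]
        have : 0 < (g' j).natAbs := Int.natAbs_pos.mpr hgj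
        omega
      exact Finset.sum_lt_sum (fun i _ => hle i) ⟨j, Finset.mem_univ j, hj'⟩
    have hzero := ih g' (by omega) h0
    exact hj (by rw [hg' j, hzero j, mul_zero])

/-- The rank consequence: under the hypotheses of `linearIndependent_of_twoTorsion`,
`r ≤ rank_ℤ E(F)` (as cardinals). [cite: SilvermanAEC2009, Prop. X.1.4] -/
theorem le_rank_of_twoTorsion (h : W.SplitTwoTorsion e₁ e₂ e₃) {V : Type*}
    [AddCommGroup V] [Module (ZMod 2) V] (ψ : W.Point →+ V) {r : ℕ} (P : Fin r → W.Point)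
    (h₃ : ψ (some e₃ _ (nonsingular_twoTorsion h.swap₂₃.swap₁₂)) =
      ψ (some e₁ _ (nonsingular_twoTorsion h)) + ψ (some e₂ _ (nonsingular_twoTorsion h.swap₁₂)))
    (hind : ∀ (c : Fin r → ZMod 2) (ε₁ ε₂ : ZMod 2),
      ∑ i, c i • ψ (P i) + ε₁ • ψ (some e₁ _ (nonsingular_twoTorsion h)) +
        ε₂ • ψ (some e₂ _ (nonsingular_twoTorsion h.swap₁₂)) = 0 → c = 0 ∧ ε₁ = 0 ∧ ε₂ = 0) :
    (r : Cardinal) ≤ Module.rank ℤ W.Point := by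
  simpa using (linearIndependent_of_twoTorsion h ψ P h₃ hind).cardinal_lift_le_rank

end WeierstrassCurve.Affine.Point

end
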